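import Summits.QuantumFields.YangMills.Theorems.BalabanUVNodesN21ChartExponentConvexity

/-!
# N21 (NE7c) · CONVEXITY OF THE (1.2) EXPONENT — SANITY: the kept-cut package, the JOINT inhabitation of the
# convexity-free ★★★★ END's binder list (A6), and the TIGHTNESS of the convexity clause (A2)

Width seat pub-ymgap-dag-n21-w3 (g3; director-ym №197 ∕ HUMAN RULING D-0149; dag-lead WIDTH-209 N21 piece 2), node N21 = NE7c
(single-run shell-weight bound, NOT PRINTED in [Bałaban 1983–89], NOT proved), lane K3⁷ `SpineGivenEndpointR13SepCoPH`
(stmt-QuantumFields-20544, `--kind proof --supports … --as helper`).  Third file of the piece; companion of p606637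
`…N21ChartExponentConvexity` (file 1) in the sense of director-ym's STANDING A6 RULE №189 (3) and the referees' A2∕A6 lines
(ref-O READ-83∕89∕96: «the JOINT system of binders not exhibited (declared)»).

WHAT.  §1 [textbook] THE KEPT-CUT PACKAGE (any real normed space): for `K = closedBall 0 R ∩ K₀` with `K₀` convex `∋ 0` and
`0 ≤ R`, `2R < r`: `K` is convex, contains `0`, and has diameter `< r` — the three geometric binders `hK`, `h0K`, `hdiam`
of file 1's ★★∕★★★∕★★★★ and file 2's `BlockChartSU` editions, DISCHARGED for the cut shape the road uses (ball letter ∩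
convex history letters).  §2 [textbook] the model remainder: the cubic `u ↦ a·u₀³` (`0 ≤ a`) is entire and has oscillation
`≤ 65a` on the sup-norm `3`-balls about the real points of the unit ball (`|u₀| < 4` there).  §3 ★ **A6: THE BINDER LIST OF
★★★★ `slotAntiConcentration_chartLetter_of_sect1Letters_convexFree` IS JOINTLY INHABITED** — exterior `Unit` under
`dirac ()`, block `ℝ¹`, kept cut `closedBall 0 1`, exponent `½w₀² + 10⁻⁴w₀³` with the (1.2) expansion (`Qf w = w₀² =
w ⬝ᵥ (1 *ᵥ w)`, `lin = 0 = ⇑0`, `Vt w = 10⁻⁴w₀³ = Re(10⁻⁴u₀³)∘ι`), rows (1.9)∕(1.6) at `γ₀ = 1`, `d = 1`, `M = 1∕100`,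
`B₃ = 1∕48`, `M₀ = A₀ = p₀(g) = 1`, `R_k = 0`, `W_V = 10⁻⁴`, Cauchy letters `r = 3`, `B = 65·10⁻⁴`, letter `θ = 4`, `ρ = ½`:
EVERY hypothesis discharged in the kernel, both clauses with room — the (M1) conclusion for the cut law of `e^{−φ}𝟙_K` is
INHABITED through ★★★★ (not vacuous).  §4 ★ **A2: THE CONVEXITY CLAUSE IS LOAD-BEARING** — the same model with `a = 1`
(so `B = 65`, clause `8·65 ≤ 9` FALSE) is NOT convex on the unit ball: `½w₀² + w₀³` violates the chord inequality at
`−1, −½` (`not_convexOn_halfSq_add_cube`).  §5 ★ the convexity clause AT PRINT's VALUE-ROW LETTERS (`S = C·g^{1−β}·|Λ|` from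
`B16Sect1Statements.Ineq12V`, p. 357 «O(g_k^{1−β})∣Λ∣»; fixed width `r > 0`; `β < 1`) holds `∀ᶠ g → 0⁺` — «for g_k
sufficiently small» in the kernel (`eventually_convexityClause`).  §6 bookkeeping: quadratic-remainder letters ADD (a remainder =
analytic member + a second member with its own letter feeds ★ with one letter).

HONEST FRAMING.  [textbook] over file 1 BY NAME; satisfiability ∕ tightness witnesses on a toy, not estimates on Bałaban's
action; 0 def, 0 sorry; nothing of Bałaban's asserted; (M1) ∕ NE7c NOT PRINTED ∕ NOT proved; N21 NOT discharged; K3⁷ NOT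
claimed; counts unmoved (typed 28∕28 · discharged 5∕27); count-neutral; one finite 𝕋⁴ at fixed ε — the Yang–Mills mass gap
(Clay) is NOT proved by any of this: R4 closes the conditional finite-𝕋⁴ rung `BalabanLadder.UV` only; nothing continuum ∕
ℝ⁴ ∕ OS.
-/

set_option autoImplicit false

open MeasureTheory Set Function Finset Matrix Metric
open scoped ENNReal

namespace Summit.QuantumFields.YangMills.Theorems.N21ChartExponentConvexitySanity

open Literature.MathematicalPhysics.QuantumFieldTheory.Balaban1983to89.T4ShellMeasure (SlotAntiConcentration)
open Literature.MathematicalPhysics.QuantumFieldTheory.Balaban1983to89.B16Sect1Wilson (Ineq16 Ineq19)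
open Summit.QuantumFields.YangMills.Theorems.N21ChartExponentConvexity
  (slotAntiConcentration_chartLetter_of_sect1Letters_convexFree)

/-! ## §1  The kept-cut package: `closedBall 0 R ∩ K₀` is convex, contains `0`, has diameter `< r` -/

section KeptCut

variable {V : Type*} [SeminormedAddCommGroup V] [NormedSpace ℝ V]

/-- the kept cut `closedBall 0 R ∩ K₀` is convex (`hK`). [textbook] -/
theorem keptCut_convex {K₀ : Set V} (hK₀ : Convex ℝ K₀) (R : ℝ) : Convex ℝ (closedBall (0 : V) R ∩ K₀) :=
  (convex_closedBall (0 : V) R).inter hK₀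

omit [NormedSpace ℝ V] in
/-- the kept cut contains the centre (`h0K`). [textbook] -/
theorem keptCut_zero_mem {K₀ : Set V} (h0 : (0 : V) ∈ K₀) {R : ℝ} (hR : 0 ≤ R) : (0 : V) ∈ closedBall (0 : V) R ∩ K₀ :=
  ⟨mem_closedBall_self hR, h0⟩

omit [NormedSpace ℝ V] in
/-- the kept cut has diameter `< r` as soon as `2R < r` (`hdiam`). [textbook] -/
theorem keptCut_diam (K₀ : Set V) {R r : ℝ} (hRr : 2 * R < r) :
    ∀ x ∈ closedBall (0 : V) R ∩ K₀, ∀ y ∈ closedBall (0 : V) R ∩ K₀, ‖y - x‖ < r := by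
  intro x hx y hy
  have hx' : ‖x‖ ≤ R := by simpa using hx.1
  have hy' : ‖y‖ ≤ R := by simpa using hy.1
  calc ‖y - x‖ ≤ ‖y‖ + ‖x‖ := norm_sub_le _ _
    _ < r := by linarith

end KeptCut

/-! ## §2  The model remainder `a·u₀³`: entire, oscillation `≤ 65a` on the 3-balls about the unit ball -/

section Model

/-- `u ↦ a·u₀³` is complex differentiable everywhere. [textbook] -/
theorem differentiableOn_cubic (a : ℂ) (s : Set (Fin 1 → ℂ)) : DifferentiableOn ℂ (fun u : Fin 1 → ℂ => a * u 0 ^ 3) s :=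
  ((differentiable_const a).mul ((differentiable_apply (0 : Fin 1)).pow 3)).differentiableOn

/-- oscillation of `a·u₀³` (`0 ≤ a`) on the sup-norm `3`-ball about a real point of the unit ball: `≤ 65a`
(`‖u₀‖ < 4`, `|x₀| ≤ 1`, `65 = 4³ + 1³`). [textbook] -/
theorem cubic_oscillation_le {a : ℝ} (ha : 0 ≤ a) {x : Fin 1 → ℝ} (hx : ‖x‖ ≤ 1) :
    MapsTo (fun u : Fin 1 → ℂ => (a : ℂ) * u 0 ^ 3) (ball (fun i => (x i : ℂ)) 3)
      (closedBall ((a : ℂ) * (x 0 : ℂ) ^ 3) (65 * a)) := by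
  intro u hu
  rw [mem_ball, dist_eq_norm] at hu
  rw [mem_closedBall, dist_eq_norm]
  have hx0 : |x 0| ≤ 1 := (norm_le_pi_norm x 0).trans hx
  have hu0 : ‖u 0 - (x 0 : ℂ)‖ < 3 := lt_of_le_of_lt (norm_le_pi_norm (u - fun i => (x i : ℂ)) 0) hu
  have hu4 : ‖u 0‖ ≤ 4 := by
    have : ‖u 0‖ ≤ ‖u 0 - (x 0 : ℂ)‖ + ‖(x 0 : ℂ)‖ := norm_le_norm_sub_add _ _
    rw [Complex.norm_real, Real.norm_eq_abs] at this
    linarith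
  have hx1 : ‖(x 0 : ℂ)‖ ≤ 1 := by rw [Complex.norm_real, Real.norm_eq_abs]; exact hx0
  calc ‖(a : ℂ) * u 0 ^ 3 - (a : ℂ) * (x 0 : ℂ) ^ 3‖ = ‖(a : ℂ)‖ * ‖u 0 ^ 3 - (x 0 : ℂ) ^ 3‖ := by
        rw [← mul_sub, norm_mul]
    _ ≤ a * (‖u 0‖ ^ 3 + ‖(x 0 : ℂ)‖ ^ 3) := by
        rw [Complex.norm_real, Real.norm_eq_abs, abs_of_nonneg ha]
        refine mul_le_mul_of_nonneg_left ((norm_sub_le _ _).trans ?_) ha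
        rw [norm_pow, norm_pow]
    _ ≤ a * (4 ^ 3 + 1 ^ 3) := by gcongr
    _ = 65 * a := by ring

end Model

/-! ## §3  ★ A6: the binder list of the convexity-free ★★★★ END is jointly inhabited -/

section Witness

/-- ★ **A6 WITNESS OF ★★★★ `slotAntiConcentration_chartLetter_of_sect1Letters_convexFree`** (director-ym STANDING A6 RULE
№189 (3)): exterior `Unit` under `dirac ()`, block `ℝ¹`, kept cut `closedBall 0 1` (convex, `∋ 0`, diameter `≤ 2 < r = 3`),
exponent `φ w = ½w₀² + 10⁻⁴w₀³` with the (1.2) expansion (`Qf w = w₀² = w ⬝ᵥ (1 *ᵥ w)`, `lin = 0 = ⇑0`,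
`Vt w = 10⁻⁴w₀³ = Re (10⁻⁴u₀³)∘ι`, `Φ u = 10⁻⁴u₀³` entire, oscillation `≤ 65·10⁻⁴` (§2)), rows at `γ₀ = 1`, `d = 1`,
`M = 1∕100` (so `100M = 1`), `B₃ = 1∕48`, `M₀ = A₀ = p₀(g) = 1`, `R_k = 0` ((1.6): `|0| < 1∕16`), `|Vt| ≤ W_V = 10⁻⁴` on
the cut, letter `θ = 4`, `ρ = ½`: convexity clause `8·1·1·(65·10⁻⁴) ≤ 1·3²` and END clause
`16·(1∕16 + 10⁻⁴)·1·1 ≤ 1·(4·½)²`, both WITH ROOM — every hypothesis discharged in the kernel.  A satisfiability witness of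
the joint binder list, not an estimate on Bałaban's measure. [textbook] -/
theorem chartLetter_convexFree_binders_inhabited :
    SlotAntiConcentration
      ((((Measure.dirac ()).prod (volume : Measure (Fin 1 → ℝ))).withDensity
          fun p : Unit × (Fin 1 → ℝ) =>
            (closedBall (0 : Fin 1 → ℝ) 1).indicator
              (fun w => ENNReal.ofReal (Real.exp (-(1 / 2 * w 0 ^ 2 + (1 / 10000 : ℝ) * w 0 ^ 3)))) p.2).restrict
        ({p : Unit × (Fin 1 → ℝ) | ‖p.2‖ < 4} ∩ univ))
      (fun p : Unit × (Fin 1 → ℝ) => ‖p.2‖) 4 (1 / 2)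
      (3 * ((Fintype.card (Fin 1) : ℝ) + 1) * (1 + 0) / (1 * (1 - 1 / 2))) := by
  have hφm : Measurable fun w : Fin 1 → ℝ => 1 / 2 * w 0 ^ 2 + (1 / 10000 : ℝ) * w 0 ^ 3 :=
    (((measurable_pi_apply 0).pow_const 2).const_mul _).add (((measurable_pi_apply 0).pow_const 3).const_mul _)
  have hg : Measurable fun p : Unit × (Fin 1 → ℝ) =>
      (closedBall (0 : Fin 1 → ℝ) 1).indicator
        (fun w => ENNReal.ofReal (Real.exp (-(1 / 2 * w 0 ^ 2 + (1 / 10000 : ℝ) * w 0 ^ 3)))) p.2 :=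
    ((ENNReal.measurable_ofReal.comp (Real.measurable_exp.comp hφm.neg)).indicator measurableSet_closedBall).comp
      measurable_snd
  have hdot : ∀ v : Fin 1 → ℝ, v 0 ^ 2 = v ⬝ᵥ ((1 : Matrix (Fin 1) (Fin 1) ℝ) *ᵥ v) := by
    intro v
    rw [one_mulVec, dotProduct, Fin.sum_univ_one, sq]
  refine slotAntiConcentration_chartLetter_of_sect1Letters_convexFree (Measure.dirac ()) (fun _ => closedBall 0 1)
    (fun _ w => 1 / 2 * w 0 ^ 2 + (1 / 10000 : ℝ) * w 0 ^ 3) (fun _ w => w 0 ^ 2) (fun _ _ => 0)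
    (fun _ w => (1 / 10000 : ℝ) * w 0 ^ 3) hg (γ₀ := 1) (M := 1 / 100) (B₃ := 1 / 48) (M₀ := 1) (A₀ := 1) (p₀g := 1)
    (Rk := 0) (WV := 1 / 10000) (d := 1) (by norm_num) (by norm_num) (by norm_num) le_rfl (by norm_num) one_pos
    (by norm_num) (fun _ => convex_closedBall _ _) (fun _ => mem_closedBall_self zero_le_one) ?_ (fun _ => 1)
    (fun _ v => hdot v) ?_ ?_ (fun _ => 0) (fun _ _ => rfl) ?_ (fun _ u => (1 / 10000 : ℂ) * u 0 ^ 3) (r := 3)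
    (B := 65 / 10000) ?_ (fun _ x _ => differentiableOn_cubic _ _) ?_ ?_ (by norm_num) (by norm_num)
  · -- the (1.2) expansion: φ w = φ 0 + ½ Qf w + lin w + Vt w
    intro _ v _
    simp only [Pi.zero_apply]
    ring
  · -- (1.9) at γ₀ = 1, d = 1, M = 1/100, for every v
    intro _ v
    unfold Ineq19
    simp only [Fin.sum_univ_one, Nat.cast_one]
    nlinarith [sq_nonneg (v 0)]
  · -- (1.6) for lin = 0
    intro _ v _
    unfold Ineq16
    norm_num
  · -- |Vt| ≤ W_V on the cut
    intro _ v hv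
    rw [mem_closedBall, dist_zero_right] at hv
    have hv0 : |v 0| ≤ 1 := (norm_le_pi_norm v 0).trans hv
    rw [abs_mul, abs_of_pos (by norm_num : (0 : ℝ) < 1 / 10000), abs_pow]
    have : |v 0| ^ 3 ≤ 1 := by
      calc |v 0| ^ 3 ≤ 1 ^ 3 := pow_le_pow_left₀ (abs_nonneg _) hv0 3
        _ = 1 := one_pow 3
    linarith
  · -- Vt = Re Φ∘ι
    intro _ x _
    simp only [← Complex.ofReal_pow, ← Complex.ofReal_ofNat, ← Complex.ofReal_one, ← Complex.ofReal_div,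
      ← Complex.ofReal_mul, Complex.ofReal_re]
  · -- oscillation ≤ 65·10⁻⁴ (§2 at a = 10⁻⁴)
    intro _ x hx
    rw [mem_closedBall, dist_zero_right] at hx
    have h := cubic_oscillation_le (a := 1 / 10000) (by norm_num) hx
    have ha : ((1 / 10000 : ℝ) : ℂ) = (1 / 10000 : ℂ) := by push_cast; ring
    rw [ha] at h
    convert h using 2
    norm_num
  · -- diameter of the cut ≤ 2 < 3
    intro _ x hx y hy
    rw [mem_closedBall, dist_zero_right] at hx hy
    calc ‖y - x‖ ≤ ‖y‖ + ‖x‖ := norm_sub_le _ _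
      _ < 3 := by linarith

end Witness

/-! ## §4  ★ A2: the convexity clause is load-bearing -/

section Tightness

/-- ★ **THE CLAUSE IS LOAD-BEARING**: with the remainder coefficient `a = 1` instead of `10⁻⁴` (Cauchy letters `r = 3`,
`B = 65`, so `8·B = 520 > 9 = γ₀r²` — the clause of ★★ FAILS) the model exponent `½w₀² + w₀³` is NOT convex on the unit
ball: at `x = −1`, `y = −½` the midpoint value `φ(−¾) = −9∕64` exceeds the chord value `(φ(−1) + φ(−½))∕2 = −¼`. [textbook] -/
theorem not_convexOn_halfSq_add_cube :
    ¬ ConvexOn ℝ (closedBall (0 : Fin 1 → ℝ) 1) (fun w : Fin 1 → ℝ => 1 / 2 * w 0 ^ 2 + w 0 ^ 3) := by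
  intro h
  have hx : (fun _ : Fin 1 => (-1 : ℝ)) ∈ closedBall (0 : Fin 1 → ℝ) 1 := by
    rw [mem_closedBall, dist_zero_right, pi_norm_le_iff_of_nonneg zero_le_one]
    intro i
    simp
  have hy : (fun _ : Fin 1 => (-1 / 2 : ℝ)) ∈ closedBall (0 : Fin 1 → ℝ) 1 := by
    rw [mem_closedBall, dist_zero_right, pi_norm_le_iff_of_nonneg zero_le_one]
    intro i
    rw [Real.norm_eq_abs]
    norm_num
  have key := h.2 hx hy (show (0 : ℝ) ≤ 1 / 2 by norm_num) (show (0 : ℝ) ≤ 1 / 2 by norm_num)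
    (show (1 / 2 : ℝ) + 1 / 2 = 1 by norm_num)
  simp only [smul_eq_mul, Pi.add_apply, Pi.smul_apply] at key
  norm_num at key

/-- … while at `a = 1` the convexity clause of ★★ indeed fails (`8·d·(100M)^{d+1}·B = 520 > 9 = γ₀·r²` at the witness
letters `d = 1`, `100M = 1`, `B = 65`, `γ₀ = 1`, `r = 3`). [textbook] -/
theorem clause_fails_at_one : ¬ (8 * (1 : ℝ) * (100 * (1 / 100)) ^ (1 + 1) * 65 ≤ 1 * 3 ^ 2) := by norm_num

end Tightness

/-! ## §5  The convexity clause at print's value-row letters holds «for g_k sufficiently small» -/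

section Eventually

open Filter Topology

/-- ★ **THE CONVEXITY CLAUSE HOLDS FOR `g_k` SUFFICIENTLY SMALL** at print's letters: with the sup letter
`S = C·g^{1−β}·|Λ|` of the value row (p. 357; the tree's `B16Sect1Statements.Ineq12V` shape) and ANY fixed analyticity width `r > 0` (in the `1∕g_k`-rescaled variable `B′`
the complex width of the chart does not shrink as `g_k → 0`), `β < 1` ⇒
`∀ᶠ g → 0⁺, 16·d·(100M)^{d+1}·(C·g^{1−β}·|Λ|) ≤ γ₀·r²` — the clause of ★★′ `convexOn_expansion_of_analyticSupBound` ∕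
`convexOn_blockChartSU_expansion_of_analyticSupBound`.  (The identification of `S`, `r` with Bałaban's letters is LOCATED,
not asserted.) [textbook] -/
theorem eventually_convexityClause {C β volΛ γ₀ M r : ℝ} {d : ℕ} (hβ : β < 1) (hγ₀ : 0 < γ₀) (hr : 0 < r) :
    ∀ᶠ g : ℝ in 𝓝[>] (0 : ℝ), 16 * d * (100 * M) ^ (d + 1) * (C * g ^ (1 - β) * volΛ) ≤ γ₀ * r ^ 2 := by
  have hexp : 0 < 1 - β := by linarith
  -- `g ↦ g^{1−β}` tends to `0` as `g → 0⁺`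
  have h0 : Tendsto (fun g : ℝ => g ^ (1 - β)) (𝓝[>] (0 : ℝ)) (𝓝 0) := by
    have hc : Tendsto (fun g : ℝ => g ^ (1 - β)) (𝓝 (0 : ℝ)) (𝓝 ((0 : ℝ) ^ (1 - β))) :=
      ((Real.continuous_rpow_const hexp.le).tendsto 0)
    rw [Real.zero_rpow hexp.ne'] at hc
    exact hc.mono_left nhdsWithin_le_nhds
  have h1 : Tendsto (fun g : ℝ => 16 * d * (100 * M) ^ (d + 1) * (C * g ^ (1 - β) * volΛ)) (𝓝[>] (0 : ℝ))
      (𝓝 (16 * d * (100 * M) ^ (d + 1) * (C * 0 * volΛ))) :=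
    ((h0.const_mul C).mul_const volΛ).const_mul _
  rw [mul_zero, zero_mul, mul_zero] at h1
  exact h1.eventually (Iic_mem_nhds (by positivity))

end Eventually

/-! ## §6  Bookkeeping: quadratic-remainder letters add (remainder = analytic member + a second member) -/

section Letters

variable {V : Type*} [SeminormedAddCommGroup V] [NormedSpace ℝ V]

/-- **QUADRATIC-REMAINDER LETTERS ADD**: if `Vt₁` has the letter `(L₁, M₁)` and `Vt₂` the letter `(L₂, M₂)` on `K`, then
`Vt₁ + Vt₂` has `(L₁ + L₂, M₁ + M₂)` — so a remainder made of the analytic (1.2) member (letter `2B∕r²`, file 1 §3) plus any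
second member with its own letter (e.g. a chart-Jacobian term) feeds ★ `convexOn_expansion_of_quadraticRemainder` ∕ its
`BlockChartSU` edition with ONE letter. [textbook] -/
theorem quadraticRemainderLetter_add {K : Set V} {Vt₁ Vt₂ : V → ℝ} {L₁ L₂ : V → V →ₗ[ℝ] ℝ} {M₁ M₂ : ℝ}
    (h₁ : ∀ x ∈ K, ∀ y ∈ K, |Vt₁ y - Vt₁ x - L₁ x (y - x)| ≤ M₁ * ‖y - x‖ ^ 2)
    (h₂ : ∀ x ∈ K, ∀ y ∈ K, |Vt₂ y - Vt₂ x - L₂ x (y - x)| ≤ M₂ * ‖y - x‖ ^ 2) :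
    ∀ x ∈ K, ∀ y ∈ K,
      |(Vt₁ y + Vt₂ y) - (Vt₁ x + Vt₂ x) - (L₁ x + L₂ x) (y - x)| ≤ (M₁ + M₂) * ‖y - x‖ ^ 2 := by
  intro x hx y hy
  have e : (Vt₁ y + Vt₂ y) - (Vt₁ x + Vt₂ x) - (L₁ x + L₂ x) (y - x) =
      (Vt₁ y - Vt₁ x - L₁ x (y - x)) + (Vt₂ y - Vt₂ x - L₂ x (y - x)) := by
    rw [LinearMap.add_apply]; ring
  rw [e, add_mul]
  exact (abs_add_le _ _).trans (add_le_add (h₁ x hx y hy) (h₂ x hx y hy))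

end Letters

end Summit.QuantumFields.YangMills.Theorems.N21ChartExponentConvexitySanity
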